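import Summits.QuantumFields.YangMills.Theorems.WeakCouplingRatesBulkDominatesColdBoxWBallDatumLargeField

/-!
# The Gibbs large-field bound of the Wilson box kernel RELATIVE TO A REFERENCE CONFIGURATION
# (first lemma of obligation R `KernelLargeFieldRarityFlatG` of LINE-18 v5 on crux `BulkMidWindowSU2`, stmt-QuantumFields-24006)

WHY.  LINE-18 v5 (planner ym-idea-2 g14, skeleton sha16 `3c750a3750a2f49e`, critic idea-crit-4 g8 PASS for v4) bundles as half 2 of
its registered stub `stub_potentialCorollaries` the flat-rate kernel rarity R, whose first lemma (planner-typed in HOME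
`ideators/ym-idea-2/l21/FirstLemmaR.lean` as the Prop `YmSpecificationReferenceBound ρ`) is the tree's B2
`WeakCouplingRates.ymSpecification_ball_real_le` with the Haar product ball centred at an ARBITRARY reference configuration `V : Λ → G`
(there: `V ≡ 1`) and the action on that ball controlled by a user-supplied bound `M` (there: `#Λ' · 8 m r²` from the ball datum):

* `haarProbability_ball_ref_eq` — left invariance of Haar and unitarity of `ρ`: `Haar{g : ‖ρ g − ρ v‖ ≤ r} = Haar{g : ‖ρ g − 1‖ ≤ r}`
  (`‖ρ v · A‖ = ‖A‖`, `{‖ρ g − ρ v‖ ≤ r} = (v⁻¹ · )⁻¹' {‖ρ h − 1‖ ≤ r}`);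
* `pi_ball_ref_eq` — hence the product Haar mass of the reference ball `{ζ : ∀ e, ‖ρ(ζ e) − ρ(V e)‖ ≤ r}` is `Haar(ball_r)^{#Λ}`;
* `ymSpecification_reference_real_le` — **`γ_Λ(E | η) ≤ e^{−β s₀} · e^{β M} / c_b^{#Λ}`** for every measurable `E` on which the boundary
  Wilson action is `≥ s₀`, every `0 < c_b ≤ Haar{‖ρ g − 1‖ ≤ r}`, every datum `η`, every reference `V` and every `M` bounding the action on the
  glued reference ball (numerator `≤ e^{−βs₀}`; normaliser `≥ e^{−βM} · Haar(ball_r)^{#Λ}` by restricting the product Haar measure to the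
  reference ball).  The rest of the proof is the tree's B2 verbatim.  With `V ≡ 1`, `M = #Λ'·8mr²` and a ball datum this is B2.
General compact `G`, continuous unitary `ρ`, any finite `Λ`, `β ≥ 0`.  Def-free.

HONEST LABEL: a G-generic helper toward ONE half of a registered bundle stub of a critic-passed line on the R2ξ″ RECORD-rung crux 24006;
no stub, crux, rung or summit is closed by this file; the Yang–Mills mass gap is NOT proved by any of this.

References: T. Bałaban, CMP 109 (1987) (0.15); S. Chatterjee, arXiv:1602.01222 §9.
-/

set_option autoImplicit false

noncomputable section

open MeasureTheory Finset
open scoped Matrix.Norms.L2Operator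
open Literature.Probability.LatticeModels (glueWith glueWith_apply_mem glueWith_apply_not_mem
  measurable_glueWith)
open Literature.MathematicalPhysics Literature.MathematicalPhysics.QuantumLattice
open Literature.MathematicalPhysics.QuantumFieldTheory

namespace Summit.QuantumFields.YangMills.Theorems.WeakCouplingRates

section Reference

variable {d m : ℕ} [NeZero m] {G : Type*} [Group G]
variable (ρ : G →* Matrix (Fin m) (Fin m) ℂ) (hρu : ∀ g, ρ g ∈ Matrix.unitaryGroup (Fin m) ℂ)

include hρu in
omit [NeZero m] in
/-- Unitarity: `‖ρ g − ρ v‖ = ‖ρ (v⁻¹ g) − 1‖`. -/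
theorem norm_sub_ref_eq (v g : G) : ‖ρ g - ρ v‖ = ‖ρ (v⁻¹ * g) - 1‖ := by
  have h : ρ g - ρ v = ρ v * (ρ (v⁻¹ * g) - 1) := by
    rw [mul_sub, mul_one, ← map_mul, mul_inv_cancel_left]
  rw [h]
  exact CStarRing.norm_mem_unitary_mul _ (hρu v)

include hρu in
omit [NeZero m] in
/-- The reference ball is a left translate of the ball at the identity. -/
theorem ball_ref_eq_preimage (v : G) (r : ℝ) :
    {g : G | ‖ρ g - ρ v‖ ≤ r} = (fun h => v⁻¹ * h) ⁻¹' {h : G | ‖ρ h - 1‖ ≤ r} := by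
  ext g
  simp only [Set.mem_setOf_eq, Set.mem_preimage, norm_sub_ref_eq ρ hρu v g]

variable [TopologicalSpace G] [IsTopologicalGroup G] [CompactSpace G] [MeasurableSpace G] [BorelSpace G]

include hρu in
omit [NeZero m] in
/-- **Left invariance**: the Haar mass of the ball of radius `r` around `ρ v` equals that of the ball around `1`. -/
theorem haarProbability_ball_ref_eq (v : G) (r : ℝ) :
    haarProbability G {g : G | ‖ρ g - ρ v‖ ≤ r} = haarProbability G {g : G | ‖ρ g - 1‖ ≤ r} := by
  haveI : (haarProbability G).IsMulLeftInvariant := by unfold haarProbability; infer_instance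
  rw [ball_ref_eq_preimage ρ hρu v r, measure_preimage_mul]

include hρu in
omit [NeZero m] in
/-- The product Haar measure of the reference-ball configurations on the edges of `Λ` is `Haar(ball_r)^{#Λ}`. -/
theorem pi_ball_ref_eq (Λ : Finset (Literature.MathematicalPhysics.QuantumLattice.ZdEdge d)) (V : ↥Λ → G) (r : ℝ) :
    (Measure.pi fun _ : ↥Λ => haarProbability G) {ζ : ↥Λ → G | ∀ e, ‖ρ (ζ e) - ρ (V e)‖ ≤ r} =
      (haarProbability G {g : G | ‖ρ g - 1‖ ≤ r}) ^ #Λ := by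
  have hset : {ζ : ↥Λ → G | ∀ e, ‖ρ (ζ e) - ρ (V e)‖ ≤ r} =
      Set.pi Set.univ (fun e : ↥Λ => {g : G | ‖ρ g - ρ (V e)‖ ≤ r}) := by
    ext ζ; simp
  rw [hset, Measure.pi_pi]
  simp_rw [haarProbability_ball_ref_eq ρ hρu]
  rw [Finset.prod_const, Finset.card_univ, Fintype.card_coe]

variable [SecondCountableTopology G]

include hρu in
/-- **Gibbs large-field bound for the Wilson box kernel, relative to a reference configuration.**  Let `ρ` be a continuous unitary
representation, `β ≥ 0`, `Λ` a finite edge set, `E` a measurable event on which the boundary Wilson action is at least `s₀`,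
`0 < c_b ≤ Haar{‖ρ g − 1‖ ≤ r}`, `η` any datum, `V : Λ → G` any reference configuration and `M` a bound for the boundary Wilson action
on the configurations glued from the reference ball `{ζ : ∀ e, ‖ρ(ζ e) − ρ(V e)‖ ≤ r}` and `η`.  Then
`γ_Λ(E | η) ≤ e^{−β s₀} · e^{β M} / c_b^{#Λ}`.  (B2 `ymSpecification_ball_real_le` is the case `V ≡ 1`, `M = #Λ'·8mr²`, `η` a ball datum.) -/
theorem ymSpecification_reference_real_le (hρc : Continuous ρ) {β : ℝ} (hβ : 0 ≤ β)
    (Λ : Finset (Literature.MathematicalPhysics.QuantumLattice.ZdEdge d))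
    {E : Set (LGConfig d G)} (hE : MeasurableSet E) {s₀ : ℝ}
    (hs : ∀ U ∈ E, s₀ ≤ wilsonBoundaryAction ρ Λ U) {r : ℝ} {cb : ℝ} (hcb : 0 < cb)
    (hball : cb ≤ (haarProbability G).real {g : G | ‖ρ g - 1‖ ≤ r})
    (η : LGConfig d G) (V : ↥Λ → G) {M : ℝ}
    (hM : ∀ ζ : ↥Λ → G, (∀ e, ‖ρ (ζ e) - ρ (V e)‖ ≤ r) → wilsonBoundaryAction ρ Λ (glueWith Λ ζ η) ≤ M) :
    (ymSpecification ρ β Λ η).real E ≤ Real.exp (-(β * s₀)) * Real.exp (β * M) / cb ^ #Λ := by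
  set π : Measure (↥Λ → G) := Measure.pi fun _ : ↥Λ => haarProbability G with hπ
  haveI : IsProbabilityMeasure π := by rw [hπ]; infer_instance
  set S : (↥Λ → G) → ℝ := fun ζ => wilsonBoundaryAction ρ Λ (glueWith Λ ζ η) with hS
  have hF : Measurable (E.indicator (1 : LGConfig d G → ℝ)) := measurable_const.indicator hE
  rw [← integral_indicator_one hE, integral_ymSpecification ρ hρc β Λ hF]
  -- continuity / measurability of the pulled-back weight
  have hSc : Continuous S := (continuous_wilsonBoundaryAction ρ hρc Λ).comp
    ((continuous_glueWith_prod Λ).comp (Continuous.prodMk_right η))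
  have hwc : Continuous fun ζ => Real.exp (-β * S ζ) := Real.continuous_exp.comp (continuous_const.mul hSc)
  have hS0 : ∀ ζ, 0 ≤ S ζ := fun ζ => wilsonBoundaryAction_nonneg ρ hρu Λ _
  have hw1 : ∀ ζ, Real.exp (-β * S ζ) ≤ 1 := fun ζ => by
    rw [Real.exp_le_one_iff]; nlinarith [hS0 ζ]
  -- numerator
  have hnum : ∫ ζ, E.indicator (1 : LGConfig d G → ℝ) (glueWith Λ ζ η) * Real.exp (-β * S ζ) ∂π ≤
      Real.exp (-(β * s₀)) := by
    have hpt : ∀ ζ, E.indicator (1 : LGConfig d G → ℝ) (glueWith Λ ζ η) * Real.exp (-β * S ζ) ≤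
        Real.exp (-(β * s₀)) := fun ζ => by
      by_cases hζ : glueWith Λ ζ η ∈ E
      · rw [Set.indicator_of_mem hζ, Pi.one_apply, one_mul]
        exact Real.exp_le_exp.2 (by nlinarith [hs _ hζ])
      · rw [Set.indicator_of_notMem hζ, zero_mul]; exact (Real.exp_pos _).le
    calc _ ≤ ∫ _ζ, Real.exp (-(β * s₀)) ∂π := by
          refine integral_mono_of_nonneg (ae_of_all _ fun ζ => ?_) (integrable_const _) (ae_of_all _ hpt)
          exact mul_nonneg (Set.indicator_nonneg (fun _ _ => zero_le_one) _) (Real.exp_pos _).le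
      _ = Real.exp (-(β * s₀)) := by simp
  -- denominator: restrict to the reference ball
  set B : Set (↥Λ → G) := {ζ | ∀ e, ‖ρ (ζ e) - ρ (V e)‖ ≤ r} with hB
  have hBm : MeasurableSet B := by
    have hset : B = Set.pi Set.univ (fun e : ↥Λ => {g : G | ‖ρ g - ρ (V e)‖ ≤ r}) := by ext ζ; simp [hB]
    rw [hset]
    exact MeasurableSet.univ_pi fun _ =>
      (isClosed_le ((hρc.sub continuous_const).norm) continuous_const).measurableSet
  have hπB : π.real B = ((haarProbability G).real {g : G | ‖ρ g - 1‖ ≤ r}) ^ #Λ := by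
    rw [measureReal_def, hπ, pi_ball_ref_eq ρ hρu Λ V r, ENNReal.toReal_pow, ← measureReal_def]
  have hden : Real.exp (-(β * M)) * cb ^ #Λ ≤ ∫ ζ, Real.exp (-β * S ζ) ∂π := by
    have h1 : Real.exp (-(β * M)) * cb ^ #Λ ≤ Real.exp (-(β * M)) * π.real B := by
      rw [hπB]
      exact mul_le_mul_of_nonneg_left (pow_le_pow_left₀ hcb.le hball _) (Real.exp_pos _).le
    have h2 : Real.exp (-(β * M)) * π.real B = ∫ ζ, B.indicator (fun _ => Real.exp (-(β * M))) ζ ∂π := by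
      rw [integral_indicator_const _ hBm, smul_eq_mul, mul_comm]
    have h3 : ∫ ζ, B.indicator (fun _ => Real.exp (-(β * M))) ζ ∂π ≤ ∫ ζ, Real.exp (-β * S ζ) ∂π := by
      refine integral_mono_of_nonneg (ae_of_all _ fun ζ => ?_)
        (QuantumLattice.integrable_of_bound hwc.aestronglyMeasurable (C := 1) fun ζ => ?_) (ae_of_all _ fun ζ => ?_)
      · exact Set.indicator_nonneg (fun _ _ => (Real.exp_pos _).le) _
      · rw [abs_of_pos (Real.exp_pos _)]; exact hw1 ζ
      · by_cases hζ : ζ ∈ B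
        · rw [Set.indicator_of_mem hζ]
          refine Real.exp_le_exp.2 ?_
          have hle : S ζ ≤ M := hM ζ hζ
          nlinarith
        · rw [Set.indicator_of_notMem hζ]; exact (Real.exp_pos _).le
    exact h1.trans (h2.le.trans h3)
  have hden0 : 0 < Real.exp (-(β * M)) * cb ^ #Λ := by positivity
  -- combine
  calc (∫ ζ, E.indicator (1 : LGConfig d G → ℝ) (glueWith Λ ζ η) * Real.exp (-β * S ζ) ∂π) /
        ∫ ζ, Real.exp (-β * S ζ) ∂π
      ≤ Real.exp (-(β * s₀)) / (Real.exp (-(β * M)) * cb ^ #Λ) :=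
        div_le_div₀ (Real.exp_pos _).le hnum hden0 hden
    _ = Real.exp (-(β * s₀)) * Real.exp (β * M) / cb ^ #Λ := by
        rw [Real.exp_neg (β * M)]
        field_simp

end Reference

end Summit.QuantumFields.YangMills.Theorems.WeakCouplingRates

end
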